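import Summits.MatrixMultiplication.MatrixMultiplication.Theorems.SoloInformedFamilyDoor

/-!
# The family door for general blocks `(P, Q, M)`: `hBCS` removed

Solo deliverable (informed mode). `SoloInformedCarrierFamily.matrixMultiplication_of_cwShape_door`
proved `R̃(T_{P,Q,M}) ≤ 3 ⇒ ω = 2` for all Coppersmith–Winograd-shaped carriers with non-degenerate
inner blocks CONDITIONALLY on the named fact `hBCS` (BCS Thm. (15.41) + Ex. 15.24(7) for this block
shape). `SoloInformedFamilyDoor` made the block-normal case `P = Q = 1` unconditional. Here the
general case is reduced to it inside the kernel: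

* `cwShapeTensor_restrictsTo_normBlock`: the basis change `(1 ⊕ Q′⁻ᵀ, 1 ⊕ P′⁻ᵀ, 1)` (written with
  `e·adj(P′)ᵀ`, `e·det P′ = 1`, to stay polynomial) maps `T_{P,Q,M}` onto `T_{1,1,N}`,
  `N′ = Q′⁻¹ M′ P′⁻ᵀ`, with `det N′ = det M′ /(det P′ det Q′) ≠ 0` (`det_innerBlock_normBlock`).
* `matrixMultiplication_of_cwShape_door'`: **for all `P, Q, M` with `det P′, det Q′, det M′ ≠ 0`,
  `R̃(T_{P,Q,M}) ≤ 3 ⇒ ω(ℂ) = 2`** — no hypothesis; with the uniform width `R̃ ≤ 3.25 ⇒ ω < 2.37`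
  and (from `SoloInformedCarrierFamily`) the uniform floor `3 ≤ R̃(T_{P,Q,M})`.
-/

noncomputable section

open scoped BigOperators
open Literature.Computability.AlgebraicComplexity

namespace Summit.MatrixMultiplication.MatrixMultiplication.Theorems.CarrierFamily

/-! ## General blocks `P, Q`: reduction to block-normal form -/

/-- `1 ⊕ e·adj(P′)ᵀ` (`= 1 ⊕ P′⁻ᵀ` when `e = (det P′)⁻¹`). [folklore] -/
def adjTBlock (P : Matrix (Fin 3) (Fin 3) ℂ) (e : ℂ) : Matrix (Fin 3) (Fin 3) ℂ :=
  ![![1, 0, 0], ![0, e * P 2 2, -(e * P 2 1)], ![0, -(e * P 1 2), e * P 1 1]]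

/-- The block-normal `c₀`-block `N′ = Q′⁻¹ M′ P′⁻ᵀ` (for `e = (det P′)⁻¹`, `f = (det Q′)⁻¹`; row and
column `0` zeroed). [folklore] -/
def normBlock (P Q M : Matrix (Fin 3) (Fin 3) ℂ) (e f : ℂ) : Matrix (Fin 3) (Fin 3) ℂ :=
  fun i j => if i = 0 ∨ j = 0 then 0 else ∑ k, ∑ l, adjTBlock Q f k i * M k l * adjTBlock P e l j

/-- **`T_{P,Q,M} ≥ T_{1,1,N}`, `N′ = Q′⁻¹M′P′⁻ᵀ`**: the basis change `(1 ⊕ Q′⁻ᵀ, 1 ⊕ P′⁻ᵀ, 1)`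
normalises the `a₀`- and `b₀`-blocks to identities.
[cite: BurgisserClausenShokrollahi1997, (14.24)] -/
theorem cwShapeTensor_restrictsTo_normBlock (P Q M : Matrix (Fin 3) (Fin 3) ℂ) {e f : ℂ}
    (he : e * (P 1 1 * P 2 2 - P 1 2 * P 2 1) = 1) (hf : f * (Q 1 1 * Q 2 2 - Q 1 2 * Q 2 1) = 1) :
    TensorRestrictsTo (cwShapeTensor P Q M) (cwShapeTensor 1 1 (normBlock P Q M e f)) := by
  refine ⟨fun a' a => adjTBlock Q f a a', fun b' b => adjTBlock P e b b',
    fun c' c => if c = c' then 1 else 0, fun a' b' c' => ?_⟩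
  fin_cases a' <;> fin_cases b' <;> fin_cases c' <;>
    simp [Fin.sum_univ_three, cwShapeTensor, normBlock, adjTBlock] <;>
    first | ring1 | linear_combination (-1 : ℂ) * he | linear_combination (-1 : ℂ) * hf

/-- `det N′ = (e det P′)(f det Q′) · (e f det M′)`. [folklore] -/
theorem det_innerBlock_normBlock (P Q M : Matrix (Fin 3) (Fin 3) ℂ) (e f : ℂ) :
    (innerBlock (normBlock P Q M e f)).det =
      (e * (innerBlock P).det) * (f * (innerBlock Q).det) * (e * f * (innerBlock M).det) := by
  simp only [det_innerBlock]
  simp [normBlock, adjTBlock, Fin.sum_univ_three]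
  ring

/-- **Value bound for EVERY Coppersmith–Winograd-shaped carrier with non-degenerate blocks,
unconditionally.** [cite: BurgisserClausenShokrollahi1997, Thm. (15.41), Ex. 15.24(7)] -/
theorem laserBound_cwShape {P Q M : Matrix (Fin 3) (Fin 3) ℂ} (hP : (innerBlock P).det ≠ 0)
    (hQ : (innerBlock Q).det ≠ 0) (hM : (innerBlock M).det ≠ 0) (ρ : ℝ)
    (hρ : asymptoticRank (cwShapeTensor P Q M) < ρ) : omega ℂ ≤ Real.logb 2 (4 * ρ ^ 3 / 27) := by
  set e : ℂ := ((innerBlock P).det)⁻¹ with he_def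
  set f : ℂ := ((innerBlock Q).det)⁻¹ with hf_def
  have he : e * (innerBlock P).det = 1 := inv_mul_cancel₀ hP
  have hf : f * (innerBlock Q).det = 1 := inv_mul_cancel₀ hQ
  have he' : e * (P 1 1 * P 2 2 - P 1 2 * P 2 1) = 1 := by rwa [det_innerBlock] at he
  have hf' : f * (Q 1 1 * Q 2 2 - Q 1 2 * Q 2 1) = 1 := by rwa [det_innerBlock] at hf
  have hN : (innerBlock (normBlock P Q M e f)).det ≠ 0 := by
    rw [det_innerBlock_normBlock, he, hf, one_mul, one_mul]
    refine mul_ne_zero (mul_ne_zero ?_ ?_) hM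
    · exact inv_ne_zero hP
    · exact inv_ne_zero hQ
  exact laserBound_blockNormal hN ρ ((asymptoticRank_le_of_algDegeneratesTo
    (cwShapeTensor_restrictsTo_normBlock P Q M he' hf').algDegeneratesTo).trans_lt hρ)

/-- **THE FAMILY DOOR, UNCONDITIONAL, general form**: for all `P, Q, M` with non-degenerate inner
blocks, `R̃(T_{P,Q,M}) ≤ 3 ⇒ ω(ℂ) = 2` — `matrixMultiplication_of_cwShape_door` of
`SoloInformedCarrierFamily` with its hypothesis `hBCS` REMOVED.
[cite: CoppersmithWinograd1990, §6] [cite: ConnerGesmundoLandsbergVentura2022, §5] -/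
theorem matrixMultiplication_of_cwShape_door' {P Q M : Matrix (Fin 3) (Fin 3) ℂ}
    (hP : (innerBlock P).det ≠ 0) (hQ : (innerBlock Q).det ≠ 0) (hM : (innerBlock M).det ≠ 0)
    (h : asymptoticRank (cwShapeTensor P Q M) ≤ 3) : _root_.MatrixMultiplication :=
  matrixMultiplication_of_laserBound (laserBound_cwShape hP hQ hM) h

/-- Width over the whole family: `R̃(T_{P,Q,M}) ≤ 3.25 ⇒ ω < 2.37`.
[cite: AlmanDuanVassilevskaWilliamsXuXuZhou2025, Theorem 1.1] -/
theorem omega_lt_of_asymptoticRank_cwShape_le {P Q M : Matrix (Fin 3) (Fin 3) ℂ}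
    (hP : (innerBlock P).det ≠ 0) (hQ : (innerBlock Q).det ≠ 0) (hM : (innerBlock M).det ≠ 0)
    (h : asymptoticRank (cwShapeTensor P Q M) ≤ 3.25) : omega ℂ < 2.37 := by
  have hρ : asymptoticRank (cwShapeTensor P Q M) < 3.26 := lt_of_le_of_lt h (by norm_num)
  exact (laserBound_cwShape hP hQ hM _ hρ).trans_lt WeightedLaser.logb_two_laser_bound_lt

end Summit.MatrixMultiplication.MatrixMultiplication.Theorems.CarrierFamily

end
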